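import Literature.Barriers.CriticalPhenomena.RigorousRGSmallParameterPerturbativeFunctionals
import HarnessLib

/-!
# `RigorousRGSmallParameter` (Slade, Theorem 1.4.1): the nonperturbative coordinate of §6.1 —
# `W_j(V,B)`, `I_j(V,X) = e^{-V(X)}∏_B(1 + W_j(V,B))`, the form `Z_j = e^{-u_j|Λ|}(I_j ∘ K_j)(Λ)`,
# and the initial scale `Z_0 = (I_0 ∘ 𝟙_∅)(Λ)`

Companion ("proof architecture") file of
`Literature/Barriers/CriticalPhenomena/RigorousRGSmallParameter.lean`. Slade §6.1 sets up the
representation that the renormalisation-group map (Theorem 6.3.1, whose iterate is the named fact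
`Slade2017_prop822`) propagates: "For `V ∈ 𝒰` and `X ∈ 𝒫_j`, we set
`I_j(V,X) = e^{-V(X)} ∏_{B ∈ 𝓑_j(X)}(1 + W_j(V,B))`, with `W_j` defined by (4.11). For `j = 0`,
we have `W_0 = 0` and `I_0(V,X) = e^{-V(X)}`. Let `K_0 : 𝒫_0 → 𝒩` be the identity element
`K_0 = 𝟙_∅`. Then `Z_0 = I_0(V_0,Λ)` … is also given by `Z_0 = (I_0 ∘ K_0)(Λ)`. In the
recursion … we maintain the form over all scales, as `Z_j = e^{-u_j|Λ|}(I_j ∘ K_j)(Λ)`". With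
`W_j(V,x)` from `…PerturbativeFunctionals` and the polymer calculus (blocks, circle product
`circ`, identity `unitP`) from `…Polymers`, this file defines `W_j(V,B) = Σ_{x∈B}W_j(V,x)`
((4.12)), `I_j(V,X)` and the predicate `RGForm` (`Z = e^{-u|Λ|}(I ∘ K)(Λ)`), and PROVES the
scale-`0` statements: with the zero covariance `w_0 = 0` one has `e^{tΔ_0} = id`, `F_0 ≡ 0`,
`W_0 = 0`, `I_0(V,X) = e^{-V(X)}`, and `Z_0 = e^{-V_0(Λ)}` is of the form `RGForm` with
`u_0 = 0`, `K_0 = 𝟙_∅` (`rgForm_zero`).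

Sources: G. Slade, arXiv:1611.06169, §6.1 (the displays quoted above), §4.3 (display (4.12)).

## What this file provides (definitions with proved properties; no named fact)

* **`WB`** (`W_j(V,B)`, (4.12)), **`Ifun`** (`I_j(V,X)`), **`RGForm`** (the form of `Z_j`).
* `lapC_lapCov_zero`, `expL_zero_cov`, `FC_zero_cov`, `locX_zero_fun`, **`Wfun_zero_cov`**
  (`W_0 = 0`), **`Ifun_zero_cov`** (`I_0 = e^{-V(X)}`), **`rgForm_zero`** (`Z_0 = (I_0 ∘ 𝟙_∅)(Λ)`).

## References

* [Slade2017] G. Slade, *Critical exponents for long-range O(n) models below the upper critical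
  dimension*, Commun. Math. Phys. 358 (2018) 343–436, arXiv:1611.06169 — §6.1, §4.3.
-/

noncomputable section

namespace Literature.Barriers.CriticalPhenomena

namespace LongRangePhi4

namespace PTFun

open Finset Tphi RGNorm LocalPoly Loc Polymer Literature.Probability.LatticeModels
open scoped ContDiff

variable {d M n : ℕ} [NeZero M]

/-! ### `W_j(V,B)`, `I_j(V,X)` and the form of `Z_j` -/

/-- **`W_j(V,B) = Σ_{x ∈ B} W_j(V,x)`** (display (4.12) of [Slade2017]). [cite: Slade2017, §4.3 (display (4.12))] -/
def WB (pN : ℕ) (dφ dplus : ℝ) (w : TorusSite d M → TorusSite d M → ℝ) (A : ℕ) (g ν u : ℝ)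
    (B : Finset (TorusSite d M)) : (TorusSite d M → Fin n → ℝ) → ℝ :=
  fun φ => ∑ x ∈ B, Wfun pN dφ dplus w A g ν u x φ

/-- **`I_j(V,X) = e^{-V(X)} ∏_{B ∈ 𝓑_j(X)} (1 + W_j(V,B))`** (display (6.2) of [Slade2017]), for
the local polynomial `V = gτ² + ντ + u` and `j`-blocks of side `b = L^j`. [cite: Slade2017, §6.1 (display defining I_j(V,X))] -/
def Ifun (b pN : ℕ) (dφ dplus : ℝ) (w : TorusSite d M → TorusSite d M → ℝ) (A : ℕ) (g ν u : ℝ)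
    (X : Finset (TorusSite d M)) : (TorusSite d M → Fin n → ℝ) → ℝ :=
  fun φ => Real.exp (-localPolySum g ν u X φ) * ∏ B ∈ blocksOf b X, (1 + WB pN dφ dplus w A g ν u B φ)

/-- **The form `Z_j = e^{-u_j|Λ|}(I_j ∘ K_j)(Λ)`** maintained along the flow (display (6.4) of
[Slade2017]; `∘` the circle product of polymer activities at scale `j`, blocks of side `b`). [cite: Slade2017, §6.1 (display Z_j = e^{-u_j|Λ|}(I_j ∘ K_j)(Λ))] -/
def RGForm (b : ℕ) (uj : ℝ) (I K : Finset (TorusSite d M) → (TorusSite d M → Fin n → ℝ) → ℝ)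
    (Z : (TorusSite d M → Fin n → ℝ) → ℝ) : Prop :=
  Z = fun φ => Real.exp (-uj * (Fintype.card (TorusSite d M) : ℝ)) * circ b I K univ φ

/-! ### Scale `0`: `W_0 = 0`, `I_0(V,X) = e^{-V(X)}`, `Z_0 = (I_0 ∘ 𝟙_∅)(Λ)` -/

/-- With the zero covariance the Laplacian vanishes. [folklore] -/
theorem lapC_lapCov_zero (F : (TorusSite d M → Fin n → ℝ) → ℝ) :
    lapC (basisDir d M n) (lapCov (n := n) (fun _ _ : TorusSite d M => (0 : ℝ))) F = fun _ => 0 := by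
  funext φ
  simp only [lapC, lapCov, ite_self, zero_mul, Finset.sum_const_zero]

/-- `e^{tΔ_0} = id`. [folklore] -/
theorem expL_zero_cov (A : ℕ) (t : ℝ) (F : (TorusSite d M → Fin n → ℝ) → ℝ) :
    expL (fun _ _ : TorusSite d M => (0 : ℝ)) A t F = F := by
  funext φ
  unfold expL expLap
  rw [Finset.sum_eq_single 0]
  · simp
  · intro k _ hk
    obtain ⟨k', rfl⟩ := Nat.exists_eq_succ_of_ne_zero hk
    rw [lapPow_succ, lapC_lapCov_zero]
    simp
  · intro h; exact absurd (Finset.mem_range.2 (Nat.succ_pos A)) h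

/-- **`F_0(A,B) = 0`.** [folklore] -/
theorem FC_zero_cov (A : ℕ) (P Q : (TorusSite d M → Fin n → ℝ) → ℝ) :
    FC (fun _ _ : TorusSite d M => (0 : ℝ)) A P Q = fun _ => 0 := by
  funext φ
  simp only [FC, expL_zero_cov, sub_self]

/-- `Loc_X 0 = 0`. [folklore] -/
theorem locX_zero_fun (pN : ℕ) (dφ dplus : ℝ) (a : TorusSite d M) (X : Finset (TorusSite d M)) :
    locX pN dφ dplus a X (fun _ : TorusSite d M → Fin n → ℝ => (0 : ℝ)) = fun _ => 0 := by
  have h := locX_const_mul pN dφ dplus a X (F := fun _ : TorusSite d M → Fin n → ℝ => (0 : ℝ)) contDiff_const 0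
  simp only [mul_zero, zero_mul] at h
  exact h

/-- **`W_0 = 0`** ("For `j = 0`, we have `W_0 = 0`"; `w_0 = 0`). [cite: Slade2017, §6.1 (sentence after the definition of I_j)] -/
theorem Wfun_zero_cov (pN : ℕ) (dφ dplus : ℝ) (A : ℕ) (g ν u : ℝ) (x : TorusSite d M) :
    Wfun (n := n) pN dφ dplus (fun _ _ : TorusSite d M => (0 : ℝ)) A g ν u x = fun _ => 0 := by
  funext φ
  simp only [Wfun, FC_zero_cov, locPt, locX_zero_fun, sub_self, mul_zero]

/-- **`I_0(V,X) = e^{-V(X)}`.** [cite: Slade2017, §6.1 ("and I_0(V,X) = e^{-V(X)}")] -/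
theorem Ifun_zero_cov (b pN : ℕ) (dφ dplus : ℝ) (A : ℕ) (g ν u : ℝ) (X : Finset (TorusSite d M)) :
    Ifun (n := n) b pN dφ dplus (fun _ _ : TorusSite d M => (0 : ℝ)) A g ν u X = fun φ => Real.exp (-localPolySum g ν u X φ) := by
  funext φ
  simp only [Ifun, WB, Wfun_zero_cov, Finset.sum_const_zero, add_zero, Finset.prod_const_one, mul_one]

/-- **`Z_0 = I_0(V_0,Λ) = (I_0 ∘ K_0)(Λ)` with `K_0 = 𝟙_∅`** (display (6.3) of [Slade2017]): the
representation holds at scale `0` with `u_0 = 0`. [cite: Slade2017, §6.1 (display Z_0 = (I_0 ∘ K_0)(Λ))] -/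
theorem rgForm_zero (b pN : ℕ) (dφ dplus : ℝ) (A : ℕ) (g ν u : ℝ) :
    RGForm (n := n) b 0 (Ifun b pN dφ dplus (fun _ _ : TorusSite d M => (0 : ℝ)) A g ν u) unitP
      (fun φ => Real.exp (-localPolySum g ν u univ φ)) := by
  unfold RGForm
  funext φ
  rw [circ_unitP _ (isPolymer_univ b), Ifun_zero_cov]
  simp

end PTFun

end LongRangePhi4

end Literature.Barriers.CriticalPhenomena

end
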